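import Summits.ValiantsHypothesis.ValiantsHypothesis.Theorems.KPlusLogSqLawTropicalCycleMonotone
import Summits.ValiantsHypothesis.ValiantsHypothesis.Theorems.KPlusLogSqLawTropicalBSplitGlue
import Summits.ValiantsHypothesis.ValiantsHypothesis.Theorems.KPlusLogSqLawTropicalExchange

/-!
# Route «KPlusLogSqLaw», crux `TropicalB` (stmt-ValiantsHypothesis-19771) — THE ORBIT-CONTACT LAW for GENERAL (relocating) activations:
# the later of two unique optima over a common earlier base touches EVERY exchange orbit of the earlier one

HONEST FRAMING.  Helper toward the registered stubs `stub_tropThin` / `stub_tropFat` of `Cruxes/TropicalB/Lines/birth.lean` (crux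
`Summit.ValiantsHypothesis.ValiantsHypothesis.Theses.KPlusLogSqLaw.TropicalB`, item stmt-ValiantsHypothesis-19771, route KPlusLogSqLaw;
cell `pub-symmetroid`, seat val-sym-trop-p5 g26, refuter-adjacent lane, 2026-08-29; `--supports … --as helper`).  A STRUCTURE law about
unique optima (`IsDominant`) of an ARBITRARY dominance design — NO single-token / concentration hypothesis; nothing here bounds `TropicalB`,
and nothing bears on `WeakLifting`, DoorA26 / DoorA34, `MatrixDescartes` (stmt-ValiantsHypothesis-18050) or VP ≠ VNP.  It is the seat's
answer to the desk's RELOCATION question (R3234 (B) / R3243 (2)): what survives of the contact laws when an activation moves lower tokens,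
so that its deviation from the base splits into several exchange orbits.

THE LAW (`orbit_contact`).  `B`, `P`, `Q` unique optima at `θB < θP < θQ`.  Then EVERY column set `O` invariant under the quotient `σ_B⁻¹σ_P` on
which `P` differs from `B` — in particular every exchange ORBIT of the earlier activation `P` — contains a column at which the later activation
`Q` deviates from `B`.  For single-token activations (one orbit) this is the sunflower law at the base; for relocating activations it is new,
and it is ASYMMETRIC: the earlier activation need not touch every orbit of the later one.  Located (HOME/val-sym-trop-p5/g26/exp/
orbit_contact_check.py, all activation pairs over a common state of the cell's seven cube chains, most of them relocating): 454/454 the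
stated way, 433/454 the converse way.  (By contrast the triple form of the single-contact law C2 fails for relocating pairs — up to five
triple columns occur — while the located hub of ALL activations persists; memo HOME/val-sym-trop-p5/g26/ONE-RUN-g26.md §4.)

PROOF (exchange argument).  If `Q = B` on `O`, the hybrids `T = (P on O, Q elsewhere)` and `H = (B on O, P elsewhere)` are present terms
(`exists_perm_restrict`, …TropicalCycleMonotone — `O` is invariant under `σ_Q⁻¹σ_P` as well, because `σ_Q = σ_B` on `O`); `Q` beats `T` at `θQ`
and `P` beats `H` at `θP`, which reads `θQ·g < V_P(O) − V_B(O) < θP·g` for the exponent gain `g` of `P` on `O`, positive by cyclewise monotonicity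
(`sum_d_lt_of_isDominant_invariant`); hence `θQ < θP`, a contradiction.

[this cell; folklore ingredients (exchange / hybrid terms)]
-/

set_option linter.dupNamespace false
set_option autoImplicit false

namespace Summit.ValiantsHypothesis.ValiantsHypothesis.Theorems.KPlusLogSqLaw

namespace OrbitContact

open Summit.ValiantsHypothesis.ValiantsHypothesis.Theorems.MatrixDescartes.Negative
open Summit.ValiantsHypothesis.ValiantsHypothesis.Theorems.LacunarySymmetroidMatrixDescartes
open Finset

variable {m K : ℕ} (d : Fin K → ℕ) (v ε : Fin m → Fin m → Fin K → ℤ)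

/-- sums over `univ` of an `if b ∈ O` split into the two parts. [elementary] -/
theorem sum_ite_mem_split (O : Finset (Fin m)) (f g : Fin m → ℤ) :
    ∑ b, (if b ∈ O then f b else g b) = ∑ b ∈ O, f b + ∑ b ∈ Oᶜ, g b := by
  rw [Finset.sum_ite]
  congr 1
  · congr 1; ext b; simp
  · congr 1; ext b; simp

/-- **THE ORBIT-CONTACT LAW** (general activations — NO concentration hypothesis).  `B`, `P`, `Q` unique optima at `θB < θP < θQ`.  Then every
column set `O` invariant under the quotient `σ_B⁻¹σ_P` on which `P` differs from `B` — in particular every exchange orbit of the EARLIER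
activation `P` — contains a column at which the LATER activation `Q` deviates from `B`.  (For single-token activations this is the sunflower
law; for RELOCATING activations, whose deviation splits into several orbits, it says the later activation touches EVERY orbit of the earlier
one; the converse fails — located HOME/val-sym-trop-p5/g26/exp/orbit_contact_check.py: 454/454 pairs of the cell's seven cube chains one way,
433/454 the other way.)  Proof: if `Q = B` on `O`, the hybrids `T = (P on O, Q elsewhere)` and `H = (B on O, P elsewhere)` are present terms;
`Q` beats `T` at `θQ` and `P` beats `H` at `θP`, giving `θQ·g < V_P(O) − V_B(O) < θP·g` for the exponent gain `g > 0` of `P` on `O` (cyclewise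
monotonicity, `sum_d_lt_of_isDominant_invariant`), so `θQ < θP`. [this cell; folklore ingredients (exchange argument)] -/
theorem orbit_contact {θB θP θQ : ℤ} {B P Q : Equiv.Perm (Fin m) × (Fin m → Fin K)}
    (hB : IsDominant d v ε θB B) (hP : IsDominant d v ε θP P) (hQ : IsDominant d v ε θQ Q) (hBP : θB < θP) (hPQ : θP < θQ)
    (O : Finset (Fin m)) (hO : ∀ b, (B.1⁻¹ * P.1) b ∈ O ↔ b ∈ O) (hdiff : ∃ b ∈ O, P.1 b ≠ B.1 b ∨ P.2 b ≠ B.2 b) :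
    ∃ c ∈ O, ¬ (Q.1 c = B.1 c ∧ Q.2 c = B.2 c) := by
  classical
  by_contra hnone
  have hQB : ∀ c ∈ O, Q.1 c = B.1 c ∧ Q.2 c = B.2 c := by
    intro c hc; by_contra h; exact hnone ⟨c, hc, h⟩
  obtain ⟨σB, lB⟩ := B
  obtain ⟨σP, lP⟩ := P
  obtain ⟨σQ, lQ⟩ := Q
  dsimp only at hO hdiff hQB hB hP hQ
  -- the exponent gain of `P` on `O` is positive
  have hdiff' : ∃ b ∈ O, σB b ≠ σP b ∨ lB b ≠ lP b := by
    obtain ⟨b, hb, h⟩ := hdiff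
    exact ⟨b, hb, h.imp Ne.symm Ne.symm⟩
  have hg := sum_d_lt_of_isDominant_invariant d v ε hBP hB hP O hO hdiff'
  -- presence of the cells
  have prB := (termSign_ne_zero_iff ε (σB, lB)).1 hB.1
  have prP := (termSign_ne_zero_iff ε (σP, lP)).1 hP.1
  have prQ := (termSign_ne_zero_iff ε (σQ, lQ)).1 hQ.1
  -- (H) the hybrid «B on O, P elsewhere», beaten by `P`
  obtain ⟨π, hπ, hπ', hπmem⟩ := exists_perm_restrict (σB⁻¹ * σP) O hO
  let H : Equiv.Perm (Fin m) × (Fin m → Fin K) := (σP * π⁻¹, fun b => if b ∈ O then lB b else lP b)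
  have hH1 : ∀ b, (σP * π⁻¹) b = if b ∈ O then σB b else σP b := by
    intro b
    by_cases hb : b ∈ O
    · rw [if_pos hb, Equiv.Perm.mul_apply]
      have hc : π⁻¹ b ∈ O := (hπmem (π⁻¹ b)).1 (by simpa using hb)
      have hπc : (σB⁻¹ * σP) (π⁻¹ b) = b := by rw [← hπ _ hc]; simp
      rw [Equiv.Perm.mul_apply, Equiv.Perm.inv_eq_iff_eq] at hπc
      exact hπc
    · rw [if_neg hb, Equiv.Perm.mul_apply]
      have : π⁻¹ b = b := by rw [Equiv.Perm.inv_eq_iff_eq]; exact (hπ' b hb).symm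
      rw [this]
  have hHpres : termSign ε H ≠ 0 := by
    rw [termSign_ne_zero_iff]
    intro b
    show ε ((σP * π⁻¹) b) b (if b ∈ O then lB b else lP b) ≠ 0
    rw [hH1]
    by_cases hb : b ∈ O
    · rw [if_pos hb, if_pos hb]; exact prB b
    · rw [if_neg hb, if_neg hb]; exact prP b
  have hHne : H ≠ (σP, lP) := by
    obtain ⟨b, hb, hbd⟩ := hdiff
    intro h
    have h1 : H.1 b = σP b := by rw [h]
    have h2 : H.2 b = lP b := by rw [h]
    change (σP * π⁻¹) b = σP b at h1
    change (if b ∈ O then lB b else lP b) = lP b at h2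
    rw [hH1, if_pos hb] at h1
    rw [if_pos hb] at h2
    rcases hbd with h' | h'
    · exact h' h1.symm
    · exact h' h2.symm
  have hPH := hP.2 H hHne hHpres
  -- (T) the hybrid «P on O, Q elsewhere», beaten by `Q`
  have hO' : ∀ b, (σQ⁻¹ * σP) b ∈ O ↔ b ∈ O := by
    intro b
    constructor
    · intro hb
      -- `σQ = σB` at the column `(σQ⁻¹σP) b ∈ O`, so `(σB⁻¹σP) b = (σQ⁻¹σP) b ∈ O`
      have e : σQ ((σQ⁻¹ * σP) b) = σB ((σQ⁻¹ * σP) b) := (hQB _ hb).1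
      have hc : (σB⁻¹ * σP) b = (σQ⁻¹ * σP) b := by
        rw [Equiv.Perm.mul_apply, Equiv.Perm.inv_eq_iff_eq, ← e]
        simp
      exact (hO b).1 (hc ▸ hb)
    · intro hb
      have h1 : (σB⁻¹ * σP) b ∈ O := (hO b).2 hb
      have e : σQ ((σB⁻¹ * σP) b) = σB ((σB⁻¹ * σP) b) := (hQB _ h1).1
      have h2 : (σQ⁻¹ * σP) b = (σB⁻¹ * σP) b := by
        rw [Equiv.Perm.mul_apply, Equiv.Perm.inv_eq_iff_eq, e]
        simp
      rw [h2]; exact h1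
  obtain ⟨π', hπ'1, hπ'2, hπ'mem⟩ := exists_perm_restrict (σQ⁻¹ * σP) O hO'
  let T : Equiv.Perm (Fin m) × (Fin m → Fin K) := (σQ * π', fun b => if b ∈ O then lP b else lQ b)
  have hT1 : ∀ b, (σQ * π') b = if b ∈ O then σP b else σQ b := by
    intro b
    by_cases hb : b ∈ O
    · rw [if_pos hb, Equiv.Perm.mul_apply, hπ'1 b hb]; simp
    · rw [if_neg hb, Equiv.Perm.mul_apply, hπ'2 b hb]
  have hTpres : termSign ε T ≠ 0 := by
    rw [termSign_ne_zero_iff]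
    intro b
    show ε ((σQ * π') b) b (if b ∈ O then lP b else lQ b) ≠ 0
    rw [hT1]
    by_cases hb : b ∈ O
    · rw [if_pos hb, if_pos hb]; exact prP b
    · rw [if_neg hb, if_neg hb]; exact prQ b
  have hTne : T ≠ (σQ, lQ) := by
    obtain ⟨b, hb, hbd⟩ := hdiff
    intro h
    have h1 : T.1 b = σQ b := by rw [h]
    have h2 : T.2 b = lQ b := by rw [h]
    change (σQ * π') b = σQ b at h1
    change (if b ∈ O then lP b else lQ b) = lQ b at h2
    rw [hT1, if_pos hb, (hQB b hb).1] at h1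
    rw [if_pos hb, (hQB b hb).2] at h2
    rcases hbd with h' | h'
    · exact h' h1
    · exact h' h2
  have hQT := hQ.2 T hTne hTpres
  -- bookkeeping of the two inequalities
  rw [TropicalCensus.tropWeight_eq_slope_sub, TropicalCensus.tropWeight_eq_slope_sub] at hPH hQT
  unfold TropicalCensus.slope at hPH hQT
  have sH : ∑ i, ((d (H.2 i) : ℕ) : ℤ) = ∑ i ∈ O, (d (lB i) : ℤ) + ∑ i ∈ Oᶜ, (d (lP i) : ℤ) := by
    rw [← sum_ite_mem_split]; refine sum_congr rfl fun b _ => ?_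
    show ((d (if b ∈ O then lB b else lP b) : ℕ) : ℤ) = _
    split_ifs <;> rfl
  have vH : ∑ i, v (H.1 i) i (H.2 i) = ∑ i ∈ O, v (σB i) i (lB i) + ∑ i ∈ Oᶜ, v (σP i) i (lP i) := by
    rw [← sum_ite_mem_split]; refine sum_congr rfl fun b _ => ?_
    show v ((σP * π⁻¹) b) b (if b ∈ O then lB b else lP b) = _
    rw [hH1]; split_ifs <;> rfl
  have sT : ∑ i, ((d (T.2 i) : ℕ) : ℤ) = ∑ i ∈ O, (d (lP i) : ℤ) + ∑ i ∈ Oᶜ, (d (lQ i) : ℤ) := by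
    rw [← sum_ite_mem_split]; refine sum_congr rfl fun b _ => ?_
    show ((d (if b ∈ O then lP b else lQ b) : ℕ) : ℤ) = _
    split_ifs <;> rfl
  have vT : ∑ i, v (T.1 i) i (T.2 i) = ∑ i ∈ O, v (σP i) i (lP i) + ∑ i ∈ Oᶜ, v (σQ i) i (lQ i) := by
    rw [← sum_ite_mem_split]; refine sum_congr rfl fun b _ => ?_
    show v ((σQ * π') b) b (if b ∈ O then lP b else lQ b) = _
    rw [hT1]; split_ifs <;> rfl
  have sP : ∑ i, ((d (lP i) : ℕ) : ℤ) = ∑ i ∈ O, (d (lP i) : ℤ) + ∑ i ∈ Oᶜ, (d (lP i) : ℤ) := (sum_add_sum_compl O _).symm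
  have vP : ∑ i, v (σP i) i (lP i) = ∑ i ∈ O, v (σP i) i (lP i) + ∑ i ∈ Oᶜ, v (σP i) i (lP i) := (sum_add_sum_compl O _).symm
  have sQ : ∑ i, ((d (lQ i) : ℕ) : ℤ) = ∑ i ∈ O, (d (lQ i) : ℤ) + ∑ i ∈ Oᶜ, (d (lQ i) : ℤ) := (sum_add_sum_compl O _).symm
  have vQ : ∑ i, v (σQ i) i (lQ i) = ∑ i ∈ O, v (σQ i) i (lQ i) + ∑ i ∈ Oᶜ, v (σQ i) i (lQ i) := (sum_add_sum_compl O _).symm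
  -- on `O`, `Q = B`
  have sQO : ∑ i ∈ O, (d (lQ i) : ℤ) = ∑ i ∈ O, (d (lB i) : ℤ) := sum_congr rfl fun i hi => by rw [(hQB i hi).2]
  have vQO : ∑ i ∈ O, v (σQ i) i (lQ i) = ∑ i ∈ O, v (σB i) i (lB i) := sum_congr rfl fun i hi => by rw [(hQB i hi).1, (hQB i hi).2]
  simp only [] at hPH hQT
  rw [sH, vH] at hPH
  rw [sT, vT] at hQT
  rw [sP, vP] at hPH
  rw [sQ, vQ, sQO, vQO] at hQT
  -- `θQ·g < V_P(O) − V_B(O) < θP·g` with `g > 0`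
  have hg' : 0 < ∑ b ∈ O, (d (lP b) : ℤ) - ∑ b ∈ O, (d (lB b) : ℤ) := by linarith
  nlinarith

end OrbitContact

end Summit.ValiantsHypothesis.ValiantsHypothesis.Theorems.KPlusLogSqLaw
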